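import Summits.ResolutionOfSingularities.ResolutionOfSingularities.Theorems.WildConesClassicalRegimesStubMuDropCharTwoOrdPLeaves

/-!
# Milnor drop in characteristic two (`stub_muDropCharTwoOrdP`) — helper 6/8: Jets

Helper file for the stub `stub_muDropCharTwoOrdP` of crux `ClassicalRegimes`
(stmt-ResolutionOfSingularities-16884, route `WildCones`, line `milnor-descent`): the one-step drop
of the Milnor number `μ = dim_κ κ⟦u₁,…,uₙ⟧/(∂a)` of the cleaned state of `z² = a(u)` under the
point-blow-up dynamics in characteristic two, `n ≥ 3`. The proof works on formal power series:
a hyperbolic pair `u_j u_l` of the quadratic part of `a` is split off by the formal coordinate change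
`u_j ↦ q⁻¹ ∂_l a, u_l ↦ q⁻¹ ∂_j a` (formal inverse function theorem; `∂_j ∂_j = 0` in
characteristic two makes `∂_j ã ∈ (u_l)`, `∂_l ã ∈ (u_j)`), which commutes with the strict
transform; killing `u_j, u_l` descends to `n - 2` variables with the same Milnor algebras. The
leaves: `n ≥ 3` residual variables without hyperbolic pair are not isolated (Case A), `n = 1` is
`μ = ord - 1`, and `n = 2` is Max Noether's inequality `I(∂ₓa, ∂_y a) ≥ m m' + I(strict transforms)`
at the point of the exceptional line plus the multiplicity `≤ 3` of that line in `(∂G)`.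
Sources: G.-M. Greuel, G. Pfister, *The splitting lemma in any characteristic*, J. Algebra 689
(2026) = arXiv:2507.17078, Thm. 3.5 / Cor. 3.7 (the hyperbolic pair; only its linear part is used);
E. Casas-Alvero, *Singularities of Plane Curves*, §3 (Noether's formula); folklore otherwise.

This file: jets of `κ⟦x,y⟧` (`2 dim κ⟦x,y⟧/𝔪^N = N(N+1)`), the coefficients of the blow-up `(x, xy)`, and the division and preimage steps of Max Noether's inequality.
-/

noncomputable section

-- single-problem summit: the doubled namespace component `ResolutionOfSingularities` is forced
set_option linter.dupNamespace false

open scoped BigOperators Classical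

open MvPowerSeries IsLocalRing

open Literature.AlgebraicGeometry.Resolution

namespace Summit.ResolutionOfSingularities.ResolutionOfSingularities.Theorems.WildCones

namespace MuDropCharTwoOrdP

variable {κ : Type} [Field κ]

/-! ## Jets of `κ⟦x, y⟧` and the coefficients of the blow-up `(x, x y)` -/

section Jets

/-- Evaluating `single 0 p + single 1 q`. [folklore] -/
theorem finTwo_pair_apply (p q : ℕ) :
    (Finsupp.single 0 p + Finsupp.single 1 q : Fin 2 →₀ ℕ) 0 = p ∧
      (Finsupp.single 0 p + Finsupp.single 1 q : Fin 2 →₀ ℕ) 1 = q := by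
  simp

/-- Exponents of the form `(p, q)`. [folklore] -/
theorem finTwo_pair_eq_iff (p q p' q' : ℕ) :
    (Finsupp.single 0 p + Finsupp.single 1 q : Fin 2 →₀ ℕ) = Finsupp.single 0 p' + Finsupp.single 1 q' ↔
      p = p' ∧ q = q' := by
  constructor
  · intro h
    have h0 := DFunLike.congr_fun h 0
    have h1 := DFunLike.congr_fun h 1
    rw [(finTwo_pair_apply p q).1, (finTwo_pair_apply p' q').1] at h0
    rw [(finTwo_pair_apply p q).2, (finTwo_pair_apply p' q').2] at h1
    exact ⟨h0, h1⟩
  · rintro ⟨rfl, rfl⟩; rfl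

/-- COEFFICIENTS ALONG `(x, x y)`: `[x^p y^q] (h∘B) = [x^{p-q} y^q] h` if `q ≤ p`, and `0` otherwise.
[folklore] -/
theorem coeff_subst_blow' (h : MvPowerSeries (Fin 2) κ) (E : Fin 2 →₀ ℕ) :
    coeff E (subst (![X 0, X 0 * X 1] : Fin 2 → MvPowerSeries (Fin 2) κ) h) =
      if E 1 ≤ E 0 then coeff (Finsupp.single 0 (E 0 - E 1) + Finsupp.single 1 (E 1)) h else 0 := by
  have finTwo_eq : ∀ e : Fin 2 →₀ ℕ, e = Finsupp.single 0 (e 0) + Finsupp.single 1 (e 1) := fun e =>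
    Finsupp.ext fun s => by fin_cases s <;> simp
  split_ifs with hE
  · have := PlaneGerm.coeff_subst_blow h (Finsupp.single 0 (E 0 - E 1) + Finsupp.single 1 (E 1))
    rw [(finTwo_pair_apply _ _).1, (finTwo_pair_apply _ _).2, Nat.sub_add_cancel hE] at this
    conv_lhs => rw [finTwo_eq E]
    exact this
  · -- adapted from `Literature.AlgebraicGeometry.Resolution.PlaneGerm.coeff_subst_of_prod_eq_monomial`
    rw [coeff_subst PlaneGerm.hasSubst_blow]
    apply finsum_eq_zero_of_forall_eq_zero
    intro d
    rw [PlaneGerm.prod_pow_blow, coeff_monomial, if_neg, smul_zero]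
    intro hdE
    apply hE
    rw [finTwo_eq E, finTwo_pair_eq_iff] at hdE
    omega

/-- JETS: `dim κ⟦x,y⟧ / 𝔪^(N+1) = dim κ⟦x,y⟧ / 𝔪^N + (N + 1)`. [folklore] -/
theorem finrank_quot_maximalIdeal_pow_succ (N : ℕ) :
    Module.finrank κ (MvPowerSeries (Fin 2) κ ⧸ maximalIdeal (MvPowerSeries (Fin 2) κ) ^ (N + 1)) =
      Module.finrank κ (MvPowerSeries (Fin 2) κ ⧸ maximalIdeal (MvPowerSeries (Fin 2) κ) ^ N) + (N + 1) := by
  have finTwo_eq : ∀ e : Fin 2 →₀ ℕ, e = Finsupp.single 0 (e 0) + Finsupp.single 1 (e 1) := fun e =>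
    Finsupp.ext fun s => by fin_cases s <;> simp
  have finTwo_degree : ∀ e : Fin 2 →₀ ℕ, e.degree = e 0 + e 1 := fun e => by
    rw [Finsupp.degree_eq_sum, Fin.sum_univ_two]
  set m := maximalIdeal (MvPowerSeries (Fin 2) κ) with hm
  haveI := Literature.RingTheory.MvPowerSeries.Jets.finite_quotient_maximalIdeal_pow (σ := Fin 2)
    (K := κ) (N + 1)
  haveI := Literature.RingTheory.MvPowerSeries.Jets.finite_quotient_maximalIdeal_pow (σ := Fin 2)
    (K := κ) N
  have hle : (m ^ (N + 1)).restrictScalars κ ≤ (m ^ N).restrictScalars κ :=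
    fun z hz => Ideal.pow_le_pow_right (Nat.le_succ N) hz
  let π : (MvPowerSeries (Fin 2) κ ⧸ m ^ (N + 1)) →ₗ[κ] (MvPowerSeries (Fin 2) κ ⧸ m ^ N) :=
    Submodule.mapQ ((m ^ (N + 1)).restrictScalars κ) ((m ^ N).restrictScalars κ) LinearMap.id hle
  have hπ : ∀ z, π (Submodule.Quotient.mk z) = Submodule.Quotient.mk z := fun z =>
    Submodule.mapQ_apply _ _ _ z
  have hsurj : Function.Surjective π := by
    intro z
    obtain ⟨z, rfl⟩ := Submodule.Quotient.mk_surjective _ z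
    exact ⟨Submodule.Quotient.mk z, hπ z⟩
  -- the degree-`N` forms
  let Pv : (Fin (N + 1) → κ) → MvPowerSeries (Fin 2) κ := fun v =>
    ∑ a : Fin (N + 1), v a • monomial (Finsupp.single 0 (a : ℕ) + Finsupp.single 1 (N - a)) (1 : κ)
  have hPv : ∀ v, Pv v = ∑ a : Fin (N + 1),
      v a • monomial (Finsupp.single 0 (a : ℕ) + Finsupp.single 1 (N - a)) (1 : κ) := fun v => rfl
  have hPadd : ∀ v w, Pv (v + w) = Pv v + Pv w := fun v w => by
    rw [hPv, hPv, hPv, ← Finset.sum_add_distrib]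
    refine Finset.sum_congr rfl fun a _ => ?_
    rw [Pi.add_apply, add_smul]
  have hPsmul : ∀ (c : κ) v, Pv (c • v) = c • Pv v := fun c v => by
    rw [hPv, hPv, Finset.smul_sum]
    refine Finset.sum_congr rfl fun a _ => ?_
    rw [Pi.smul_apply, smul_smul, smul_eq_mul]
  have hcoeff : ∀ (v : Fin (N + 1) → κ) (b : Fin (N + 1)),
      coeff (Finsupp.single 0 (b : ℕ) + Finsupp.single 1 (N - b)) (Pv v) = v b := by
    intro v b
    rw [hPv, map_sum, Finset.sum_eq_single b]
    · rw [coeff_smul, coeff_monomial_same, mul_one]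
    · intro a _ hab
      rw [coeff_smul, coeff_monomial_ne, mul_zero]
      intro h
      rw [finTwo_pair_eq_iff] at h
      exact hab (Fin.ext h.1.symm)
    · intro h; exact absurd (Finset.mem_univ b) h
  have hcoeff' : ∀ (v : Fin (N + 1) → κ) (e : Fin 2 →₀ ℕ), e.degree ≠ N → coeff e (Pv v) = 0 := by
    intro v e he
    rw [hPv, map_sum]
    refine Finset.sum_eq_zero fun a _ => ?_
    rw [coeff_smul, coeff_monomial_ne, mul_zero]
    rintro rfl
    apply he
    rw [finTwo_degree, (finTwo_pair_apply _ _).1, (finTwo_pair_apply _ _).2]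
    omega
  have hdegN : ∀ b : Fin (N + 1), (Finsupp.single 0 (b : ℕ) + Finsupp.single 1 (N - b) : Fin 2 →₀ ℕ).degree = N := by
    intro b
    rw [finTwo_degree, (finTwo_pair_apply _ _).1, (finTwo_pair_apply _ _).2]
    omega
  let lam : (Fin (N + 1) → κ) →ₗ[κ] (MvPowerSeries (Fin 2) κ ⧸ m ^ (N + 1)) :=
    { toFun := fun v => Submodule.Quotient.mk (Pv v)
      map_add' := fun v w => by rw [hPadd, Submodule.Quotient.mk_add]
      map_smul' := fun c v => by rw [RingHom.id_apply, hPsmul, Submodule.Quotient.mk_smul] }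
  have hlam : ∀ v, lam v = Submodule.Quotient.mk (Pv v) := fun v => rfl
  have hinj : Function.Injective lam := by
    rw [← LinearMap.ker_eq_bot, LinearMap.ker_eq_bot']
    intro v hv
    rw [hlam, Submodule.Quotient.mk_eq_zero] at hv
    funext b
    have := Literature.RingTheory.MvPowerSeries.Jets.coeff_eq_zero_of_mem_maximalIdeal_pow hv
      (e := Finsupp.single 0 (b : ℕ) + Finsupp.single 1 (N - b)) (by rw [hdegN]; exact Nat.lt_succ_self N)
    rw [hcoeff] at this
    exact this
  have hrange : LinearMap.range lam = LinearMap.ker π := by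
    apply le_antisymm
    · rintro _ ⟨v, rfl⟩
      rw [LinearMap.mem_ker, hlam, hπ, Submodule.Quotient.mk_eq_zero, hPv]
      refine Submodule.sum_mem _ fun a _ => Submodule.smul_of_tower_mem _ _ ?_
      exact Literature.RingTheory.MvPowerSeries.Jets.monomial_mem_maximalIdeal_pow (hdegN a).ge _
    · intro z hz
      obtain ⟨z, rfl⟩ := Submodule.Quotient.mk_surjective _ z
      rw [LinearMap.mem_ker, hπ, Submodule.Quotient.mk_eq_zero] at hz
      refine ⟨fun a => coeff (Finsupp.single 0 (a : ℕ) + Finsupp.single 1 (N - a)) z, ?_⟩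
      rw [hlam, Submodule.Quotient.eq]
      apply Literature.RingTheory.MvPowerSeries.Jets.mem_maximalIdeal_pow_of_coeff_eq_zero
      intro e he
      rw [map_sub]
      by_cases hdeg : e.degree = N
      · set b : Fin (N + 1) := ⟨e 0, by rw [finTwo_degree] at hdeg; omega⟩ with hb
        have hbv : (b : ℕ) = e 0 := rfl
        have he' : e = Finsupp.single 0 (b : ℕ) + Finsupp.single 1 (N - b) := by
          rw [finTwo_eq e, finTwo_pair_eq_iff]
          rw [finTwo_degree] at hdeg
          omega
        rw [he', hcoeff, sub_self]
      · rw [hcoeff' _ _ hdeg, zero_sub, neg_eq_zero]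
        exact Literature.RingTheory.MvPowerSeries.Jets.coeff_eq_zero_of_mem_maximalIdeal_pow hz
          (by omega)
  have h1 := LinearMap.finrank_range_add_finrank_ker π
  rw [LinearMap.range_eq_top.mpr hsurj, finrank_top, ← hrange,
    LinearEquiv.finrank_eq (LinearEquiv.ofInjective lam hinj).symm, Module.finrank_fintype_fun_eq_card,
    Fintype.card_fin] at h1
  omega

/-- JETS: `2 · dim κ⟦x,y⟧ / 𝔪^N = N (N + 1)`. [folklore] -/
theorem two_mul_finrank_quot_maximalIdeal_pow (N : ℕ) :
    2 * Module.finrank κ (MvPowerSeries (Fin 2) κ ⧸ maximalIdeal (MvPowerSeries (Fin 2) κ) ^ N) =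
      N * (N + 1) := by
  induction N with
  | zero =>
    rw [pow_zero, Ideal.one_eq_top]
    haveI : Subsingleton (MvPowerSeries (Fin 2) κ ⧸ (⊤ : Ideal (MvPowerSeries (Fin 2) κ))) :=
      Ideal.Quotient.subsingleton_iff.mpr rfl
    rw [Module.finrank_zero_of_subsingleton, mul_zero, zero_mul]
  | succ N ih =>
    rw [finrank_quot_maximalIdeal_pow_succ, mul_add, ih]
    ring

end Jets


/-! ## Max Noether's inequality `I(f, g) ≥ ord f · ord g + I(f̃, g̃)` at a point of the blow-up -/

section Noether

/-- Colengths along a chain `p ≤ q` of subspaces: `dim M/p = dim M/q + dim (q/p)`. [folklore] -/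
theorem finrank_quot_eq_add {M : Type} [AddCommGroup M] [Module κ M] (p q : Submodule κ M)
    (hpq : p ≤ q) [Module.Finite κ (M ⧸ p)] :
    Module.finrank κ (M ⧸ p) = Module.finrank κ (M ⧸ q) + Module.finrank κ (q.map p.mkQ) := by
  let π : (M ⧸ p) →ₗ[κ] (M ⧸ q) := Submodule.mapQ p q LinearMap.id hpq
  have hπ : ∀ z, π (Submodule.Quotient.mk z) = Submodule.Quotient.mk z := fun z =>
    Submodule.mapQ_apply _ _ _ z
  have hsurj : Function.Surjective π := by
    intro z
    obtain ⟨z, rfl⟩ := Submodule.Quotient.mk_surjective _ z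
    exact ⟨Submodule.Quotient.mk z, hπ z⟩
  have hker : LinearMap.ker π = q.map p.mkQ := by
    ext z
    obtain ⟨z, rfl⟩ := Submodule.Quotient.mk_surjective _ z
    rw [LinearMap.mem_ker, hπ, Submodule.Quotient.mk_eq_zero, Submodule.mem_map]
    constructor
    · intro hz; exact ⟨z, hz, rfl⟩
    · rintro ⟨z', hz', hzz⟩
      rw [Submodule.mkQ_apply, Submodule.Quotient.eq] at hzz
      have : z = z' - (z' - z) := by abel
      rw [this]
      exact q.sub_mem hz' (hpq hzz)
  have h1 := LinearMap.finrank_range_add_finrank_ker π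
  rw [LinearMap.range_eq_top.mpr hsurj, finrank_top, hker] at h1
  omega

/-- A series with non-zero restriction to the `y`-axis is `y^ν · unit + x · (…)`, `ν` the order
of the restriction. [folklore] -/
theorem exists_axis_decomposition {f : MvPowerSeries (Fin 2) κ}
    (hf : killCompl (⟨fun _ => (1 : Fin 2), fun a b _ => Subsingleton.elim a b⟩ : Fin 1 ↪ Fin 2) f ≠ 0) :
    ∃ u f₁ : MvPowerSeries (Fin 2) κ, IsUnit u ∧
      f = X 1 ^ (killCompl (⟨fun _ => (1 : Fin 2), fun a b _ => Subsingleton.elim a b⟩ :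
        Fin 1 ↪ Fin 2) f).order.toNat * u + X 0 * f₁ := by
  set e : Fin 1 ↪ Fin 2 := ⟨fun _ => (1 : Fin 2), fun a b _ => Subsingleton.elim a b⟩ with he
  obtain ⟨w, hw, hfw⟩ := exists_eq_X_pow_mul_unit hf
  have hker : f - rename e (killCompl e f) ∈ Ideal.span {(X 0 : MvPowerSeries (Fin 2) κ), X 0} := by
    apply ker_killCompl_le e range_axisEmb
    rw [RingHom.mem_ker]
    change killCompl e (f - rename e (killCompl e f)) = 0
    rw [map_sub, killCompl_rename_app, sub_self]
  obtain ⟨c, d, hcd⟩ := Ideal.mem_span_pair.mp hker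
  refine ⟨rename e w, c + d, ?_, ?_⟩
  · rw [isUnit_iff_constantCoeff, constantCoeff_rename, ← isUnit_iff_constantCoeff]; exact hw
  · have : f = rename e (killCompl e f) + (c * X 0 + d * X 0) := by rw [hcd]; ring
    conv_lhs => rw [this, hfw]
    rw [map_mul, map_pow, rename_X]
    change (X 1 : MvPowerSeries (Fin 2) κ) ^ _ * _ + _ = _
    ring

/-- DIVISION STEP for Max Noether: modulo `(f')` and `x^r`, every series is congruent to one whose
monomials `x^a y^b` satisfy `b ≤ a + k`, provided `f' = y^ν u + x f₁` with `u` a unit and `ν ≤ k`.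
[folklore] -/
theorem exists_reduction {f' u f₁ : MvPowerSeries (Fin 2) κ} (hu : IsUnit u) {ν k : ℕ} (hν : ν ≤ k)
    (hf' : f' = X 1 ^ ν * u + X 0 * f₁) (r : ℕ) (s : MvPowerSeries (Fin 2) κ) :
    ∃ μ c t : MvPowerSeries (Fin 2) κ, (∀ e : Fin 2 →₀ ℕ, e 0 + k < e 1 → coeff e μ = 0) ∧
      s = μ + c * f' + X 0 ^ r * t := by
  obtain ⟨w, hw⟩ := hu
  set wi : MvPowerSeries (Fin 2) κ := ↑(w⁻¹) with hwi
  have hwwi : u * wi = 1 := by rw [← hw, hwi]; exact w.mul_inv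
  induction r generalizing s with
  | zero => exact ⟨0, 0, s, fun _ _ => by rw [map_zero], by ring⟩
  | succ r ih =>
    obtain ⟨μ, c, t, hμ, hs⟩ := ih s
    -- split `t` at `y`-degree `r + k`
    let t₁ : MvPowerSeries (Fin 2) κ := fun e => if e 1 ≤ r + k then coeff e t else 0
    let t₂ : MvPowerSeries (Fin 2) κ := fun e => coeff (e + Finsupp.single 1 (r + k + 1)) t
    have ht₁ : ∀ e, coeff e t₁ = if e 1 ≤ r + k then coeff e t else 0 := fun e => rfl
    have ht₂ : ∀ e, coeff e t₂ = coeff (e + Finsupp.single 1 (r + k + 1)) t := fun e => rfl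
    have ht : t = t₁ + X 1 ^ (r + k + 1) * t₂ := by
      ext e
      rw [map_add, ht₁, X_pow_eq, coeff_monomial_mul, one_mul]
      by_cases he : e 1 ≤ r + k
      · rw [if_pos he, if_neg, add_zero]
        rw [Finsupp.single_le_iff]; omega
      · rw [if_neg he, zero_add, if_pos, ht₂, tsub_add_cancel_of_le]
        · rw [Finsupp.single_le_iff]; omega
        · rw [Finsupp.single_le_iff]; omega
    have hpow : (X 1 : MvPowerSeries (Fin 2) κ) ^ (r + k + 1) = X 1 ^ (r + k + 1 - ν) * X 1 ^ ν := by
      rw [← pow_add, Nat.sub_add_cancel (by omega)]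
    have key : (X 1 : MvPowerSeries (Fin 2) κ) ^ ν = (f' - X 0 * f₁) * wi := by
      rw [hf', add_sub_cancel_right, mul_assoc, hwwi, mul_one]
    refine ⟨μ + X 0 ^ r * t₁, c + X 0 ^ r * X 1 ^ (r + k + 1 - ν) * t₂ * wi,
      -(X 1 ^ (r + k + 1 - ν) * t₂ * wi * f₁), fun e he => ?_, ?_⟩
    · rw [map_add, hμ e he, zero_add, X_pow_eq, coeff_monomial_mul, one_mul]
      split_ifs with hre
      · rw [ht₁, if_neg]
        rw [Finsupp.single_le_iff] at hre
        simp only [Finsupp.coe_tsub, Pi.sub_apply, Finsupp.single_apply]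
        simp
        omega
      · rfl
    · rw [hs, ht, hpow, key]; ring

/-- PREIMAGES under `h ↦ (h∘B)/x^k`: a series whose monomials `x^a y^b` satisfy `b ≤ a + k` is
`(h∘B)/x^k` for some `h ∈ 𝔪^k`. [folklore] -/
theorem exists_blow_preimage (k : ℕ) {μ : MvPowerSeries (Fin 2) κ}
    (hμ : ∀ e : Fin 2 →₀ ℕ, e 0 + k < e 1 → coeff e μ = 0) :
    ∃ h : MvPowerSeries (Fin 2) κ, h ∈ maximalIdeal (MvPowerSeries (Fin 2) κ) ^ k ∧
      ∀ e : Fin 2 →₀ ℕ, coeff (e + Finsupp.single 0 k)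
        (subst (![X 0, X 0 * X 1] : Fin 2 → MvPowerSeries (Fin 2) κ) h) = coeff e μ := by
  have finTwo_eq : ∀ e : Fin 2 →₀ ℕ, e = Finsupp.single 0 (e 0) + Finsupp.single 1 (e 1) := fun e =>
    Finsupp.ext fun s => by fin_cases s <;> simp
  have finTwo_degree : ∀ e : Fin 2 →₀ ℕ, e.degree = e 0 + e 1 := fun e => by
    rw [Finsupp.degree_eq_sum, Fin.sum_univ_two]
  let h : MvPowerSeries (Fin 2) κ := fun e => if k ≤ e 0 + e 1 then
    coeff (Finsupp.single 0 (e 0 + e 1 - k) + Finsupp.single 1 (e 1)) μ else 0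
  have hh : ∀ e, coeff e h = if k ≤ e 0 + e 1 then
      coeff (Finsupp.single 0 (e 0 + e 1 - k) + Finsupp.single 1 (e 1)) μ else 0 := fun e => rfl
  refine ⟨h, ?_, fun e => ?_⟩
  · apply Literature.RingTheory.MvPowerSeries.Jets.mem_maximalIdeal_pow_of_coeff_eq_zero
    intro e he
    rw [finTwo_degree] at he
    rw [hh, if_neg (by omega)]
  · have h0 : (e + Finsupp.single 0 k : Fin 2 →₀ ℕ) 0 = e 0 + k := by simp
    have h1 : (e + Finsupp.single 0 k : Fin 2 →₀ ℕ) 1 = e 1 := by simp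
    rw [coeff_subst_blow', h0, h1]
    by_cases he : e 1 ≤ e 0 + k
    · rw [if_pos he, hh, (finTwo_pair_apply _ _).1, (finTwo_pair_apply _ _).2, if_pos (by omega),
        show e 0 + k - e 1 + e 1 - k = e 0 by omega]
      conv_rhs => rw [finTwo_eq e]
    · rw [if_neg he, hμ e (by omega)]

end Noether

end MuDropCharTwoOrdP

end Summit.ResolutionOfSingularities.ResolutionOfSingularities.Theorems.WildCones

end
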